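import Literature.Probability.LatticeModels.DartPhase
import Literature.Probability.LatticeModels.DirichletGreenFunction
import Literature.Probability.RandomPlanarGeometry.PlanarDomains
import Summits.CriticalPhenomena.CardyFormulaZ2.Theorems.CardySusyWardParafermionPrecompactKenyonDefs
import Literature.Probability.LatticeModels.SHolomorphicityProof

/-!
# The pointwise pair identity at spin `1/3`, I: dart sums along the cut orbit
# (helper for stub `stub_vertexRelation`)

Line `kenyon-stream-second-relation` of the crux `ParafermionPrecompact` (route `CardySusyWard`,
item stmt-CriticalPhenomena-11293). The `q = 1` replica of the tree's FK-Ising pairing computation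
(`WeightTable.lean`, `PairIdentities.lean`: Smirnov 2010, proof of Lemma 4.5) for the proof of the
vertex relation of Duminil-Copin–Smirnov 2012, Prop. 8.6 at spin `σ = 1/3`. With
`𝓊 = e^{iπ/6}` (local notation) a dart of the cut orbit with turn count `C` carries the phase
`e^{-(i/3)(π/2)C} = 𝓊^{-C}`; the DART SUM `dsum[β, c₀, N, r]` (local notation) of the cut orbit at
the coded corner `r` is the sum of these phases over the darts `j < N` carried by `r`.

* the algebra of `𝓊`: `𝓊⁶ = -1`, `𝓊³ = i`, and the only trigonometric input `𝓊⁴ - 𝓊² + 1 = 0`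
  (`2 cos(π/3) = 1`);
* `dsum_eq_dsum_prev`: the darts carried by `r` are the successors of those carried by
  `prevCorner β r`, one quarter turn later; `rel_eq`: hence the vertex combination
  `dsum p - dsum p₂ - i(dsum p⁺ - dsum p₂⁺)` of one configuration is `(1 - i𝓊⁻¹)Δ` (`e` closed)
  resp. `(1 + i𝓊)Δ` (`e` open), `Δ = dsum p - dsum p₂`;
* `dsum_case2`: the dart sums of the pair in case 2 (both darts of `e` on the path of `ω`), from
  `cornerOrbit_toggle_case2`, with the turn-sign sum of the excised stretch isolated;
* `exitIndex_unique` (registered helper): exit times of orbits are unique.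

References: H. Duminil-Copin, S. Smirnov, Clay Math. Proc. 15 (2012), §8.3
[DuminilCopinSmirnov2012Lattice]; S. Smirnov, Ann. of Math. 172 (2010), §4 [Smirnov2010].
-/

noncomputable section

namespace Summit.CriticalPhenomena.CardyFormulaZ2.Cruxes.ParafermionPrecompact.KenyonStreamSecondRelation

open Finset
open _root_.Literature.Probability.LatticeModels
open _root_.Literature.Probability.Percolation (BondConfig)
open _root_.Literature.Probability.RandomPlanarGeometry (DobrushinDomain)

/-! ## The pointwise pair identity at spin `1/3` -/

section Pair

open Complex

/-- The twelfth root of unity `𝓊 = e^{iπ/6}`: the spin-`1/3` phase of one quarter turn to the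
LEFT is `e^{-(i/3)(π/2)} = 𝓊⁻¹`, so a dart with turn count `C` carries the phase `𝓊^{-C}`. -/
local notation "𝓊" => Complex.exp (((Real.pi / 6 : ℝ) : ℂ) * Complex.I)

/-- The spin-`1/3` DART SUM of the cut orbit at the coded corner `r`: the sum over the darts
`j < N` carried by `r` of `𝓊^{-C_j}` (at most one term). -/
local notation "dsum[" β₀ ", " c ", " N ", " r "]" =>
  ∑ j ∈ Finset.filter (fun j => cornerOrbit β₀ c j = r) (Finset.range N), 𝓊 ^ (-(turnCount β₀ c j))

/-! ### The algebra of `𝓊` -/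

/-- `𝓊 ≠ 0`. [folklore] -/
theorem twelfth_ne_zero : 𝓊 ≠ 0 := Complex.exp_ne_zero _

/-- `𝓊⁶ = e^{iπ} = -1`. [folklore] -/
theorem twelfth_pow_six : 𝓊 ^ 6 = -1 := by
  rw [← Complex.exp_nat_mul, show ((6 : ℕ) : ℂ) * (((Real.pi / 6 : ℝ) : ℂ) * I) = Real.pi * I by push_cast; ring,
    Complex.exp_pi_mul_I]

/-- `𝓊³ = e^{iπ/2} = i`. [folklore] -/
theorem twelfth_pow_three : 𝓊 ^ 3 = I := by
  rw [← Complex.exp_nat_mul, show ((3 : ℕ) : ℂ) * (((Real.pi / 6 : ℝ) : ℂ) * I) = ((Real.pi / 2 : ℝ) : ℂ) * I by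
    push_cast; ring, Complex.exp_mul_I, ← Complex.ofReal_cos, ← Complex.ofReal_sin,
    Real.cos_pi_div_two, Real.sin_pi_div_two]
  simp

/-- **The only trigonometric input: `2 cos (π/3) = 1`**, in the form `𝓊⁴ - 𝓊² + 1 = 0`
(`𝓊² = e^{iπ/3}` is a primitive sixth root of unity). [folklore] -/
theorem twelfth_pow_four_sub : 𝓊 ^ 4 - 𝓊 ^ 2 + 1 = 0 := by
  have h6 : (𝓊 ^ 2 + 1) * (𝓊 ^ 4 - 𝓊 ^ 2 + 1) = 0 := by
    have := twelfth_pow_six; linear_combination this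
  rcases mul_eq_zero.1 h6 with h | h
  · exfalso
    have h2 : 𝓊 ^ 2 = Complex.exp (((Real.pi / 3 : ℝ) : ℂ) * I) := by
      rw [← Complex.exp_nat_mul]; congr 1; push_cast; ring
    have hre : (Complex.exp (((Real.pi / 3 : ℝ) : ℂ) * I)).re = 1 / 2 := by
      rw [Complex.exp_mul_I, ← Complex.ofReal_cos, ← Complex.ofReal_sin, Real.cos_pi_div_three]
      simp
    have := congrArg Complex.re (eq_neg_of_add_eq_zero_left h)
    rw [h2, hre] at this
    norm_num at this
  · exact h

/-- `𝓊^{-(m+1)} = 𝓊^{-m} 𝓊⁻¹` and `𝓊^{-(m-1)} = 𝓊^{-m} 𝓊`. [folklore] -/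
theorem twelfth_zpow_neg_add (m : ℤ) :
    𝓊 ^ (-(m + 1)) = 𝓊 ^ (-m) * 𝓊⁻¹ ∧ 𝓊 ^ (-(m + -1)) = 𝓊 ^ (-m) * 𝓊 := by
  constructor
  · rw [neg_add, zpow_add₀ twelfth_ne_zero, zpow_neg_one]
  · rw [neg_add, neg_neg, zpow_add₀ twelfth_ne_zero, zpow_one]

/-- `𝓊^{-(m+2)} = 𝓊^{-m} (𝓊^2)⁻¹` and `𝓊^{-(m-2)} = 𝓊^{-m} 𝓊^2`. [folklore] -/
theorem twelfth_zpow_neg_add_two (m : ℤ) :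
    𝓊 ^ (-(m + 2)) = 𝓊 ^ (-m) * (𝓊 ^ 2)⁻¹ ∧ 𝓊 ^ (-(m - 2)) = 𝓊 ^ (-m) * 𝓊 ^ 2 := by
  constructor
  · rw [neg_add, zpow_add₀ twelfth_ne_zero, zpow_neg]; norm_cast
  · rw [neg_sub, sub_eq_neg_add, zpow_add₀ twelfth_ne_zero]; norm_cast

/-! ### Dart sums one step downstream -/

variable {E : DiscreteDobrushin} {ω ω' : BondConfig (Site 2)} {c₀ p : Site 2 × Fin 4}

local notation "β" => E.bcBondConfig ω
local notation "β'" => E.bcBondConfig ω'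
local notation "orb" => cornerOrbit (E.bcBondConfig ω) c₀
local notation "orb'" => cornerOrbit (E.bcBondConfig ω') c₀

/-- **Dart sums one step downstream.** The darts carried by `r` are the successors of the darts
carried by its predecessor `prevCorner β r`, with one more turn (`turnSign (prev r)`) counted —
provided `r` is not the start corner and the last dart `orb (N-1)` is not the predecessor.
[cite: DuminilCopinSmirnov2012Lattice, §8.3] -/
theorem dsum_eq_dsum_prev {N : ℕ} {r : Site 2 × Fin 4} (h0 : r ≠ c₀)
    (hlast : cornerOrbit β c₀ (N - 1) ≠ prevCorner β r) :
    dsum[β, c₀, N, r] = 𝓊 ^ (-turnSign β (prevCorner β r)) * dsum[β, c₀, N, prevCorner β r] := by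
  have hfilter : (Finset.range N).filter (fun k => orb k = r) =
      ((Finset.range N).filter (fun j => orb j = prevCorner β r)).image (· + 1) := by
    ext k
    simp only [Finset.mem_filter, Finset.mem_range, Finset.mem_image]
    constructor
    · rintro ⟨hk, hkr⟩
      obtain ⟨j, rfl⟩ : ∃ j, k = j + 1 := ⟨k - 1, by
        rcases k with _ | k
        · exact absurd hkr.symm h0
        · simp⟩
      refine ⟨j, ⟨by omega, ?_⟩, rfl⟩
      rw [← hkr, cornerOrbit_succ, prevCorner_nextCorner]
    · rintro ⟨j, ⟨hj, hjr⟩, rfl⟩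
      refine ⟨?_, ?_⟩
      · by_contra h
        have : j = N - 1 := by omega
        subst this
        exact hlast hjr
      · rw [cornerOrbit_succ, hjr, nextCorner_prevCorner]
  rw [hfilter, Finset.sum_image (fun _ _ _ _ h => Nat.succ_injective h), Finset.mul_sum]
  refine Finset.sum_congr rfl fun j hj => ?_
  rw [Finset.mem_filter] at hj
  rw [turnCount, Finset.sum_range_succ, ← turnCount, hj.2, neg_add, zpow_add₀ twelfth_ne_zero, mul_comm]

/-- The four hypotheses for the two out-darts at an interior edge `e = cTgt p`: the start corner
is not sourced at `e` and the last dart of the exploration does not arrive at `e` (its target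
`e_b` has an endpoint on the arc `B`, `e` has none). [cite: Smirnov2001, §2] -/
theorem outDart_hypotheses (hE : E.IsZdAdmissible) (hc₀ : E.IsStartCorner c₀) {N : ℕ}
    (hN : ¬ E.IsInnerFace (cFace (orb N))) (hlt : ∀ k < N, E.IsInnerFace (cFace (orb k)))
    (hB : ∀ x ∈ cTgt p, x ∉ E.zdArcB) :
    (p.1, p.2 + 1) ≠ c₀ ∧ ((cornerPartner p).1, (cornerPartner p).2 + 1) ≠ c₀ ∧
      cornerOrbit β c₀ (N - 1) ≠ p ∧ cornerOrbit β c₀ (N - 1) ≠ cornerPartner p := by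
  have hsrc : ∀ r : Site 2 × Fin 4, cSrc (r.1, r.2 + 1) = cTgt r := fun r => by rw [cSrc, cTgt]
  have h0 : ∀ r : Site 2 × Fin 4, cTgt r = cTgt p → (r.1, r.2 + 1) ≠ c₀ := by
    intro r hr h
    have : cSrc c₀ = cTgt p := by rw [← h, hsrc, hr]
    exact hB _ (this ▸ Sym2.mem_mk_right _ _) hc₀.mem_zdArcB
  obtain ⟨M, rfl⟩ : ∃ M, N = M + 1 := ⟨N - 1, (Nat.succ_pred_eq_of_pos (Nat.pos_of_ne_zero fun h => by
    subst h; exact hN hc₀.isOutEdge.1)).symm⟩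
  have hlast : ∀ r : Site 2 × Fin 4, cTgt r = cTgt p → orb (M + 1 - 1) ≠ r := by
    intro r hr h
    rw [show M + 1 - 1 = M from rfl] at h
    obtain ⟨-, -, hBe, -⟩ := cornerOrbit_exit hE hc₀ (hlt M (Nat.lt_succ_self M)) hN
    rw [h] at hBe
    exact hB _ (hr ▸ Sym2.mem_mk_right _ _) hBe
  exact ⟨h0 p rfl, h0 _ (cTgt_partner p), hlast p rfl, hlast _ (cTgt_partner p)⟩

/-- **The vertex residual of one configuration in terms of the in-dart difference.** With
`Δ = dsum p - dsum (partner p)`, the combination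
`dsum p - dsum p₂ - i (dsum p⁺ - dsum p₂⁺)` (`q⁺ = (q.1, q.2 + 1)` the corner leaving `e` around
the vertex of `q`) equals `(1 - i 𝓊⁻¹) Δ` if `e` is closed and `(1 + i 𝓊) Δ` if `e` is open:
the out-darts are the successors of the in-darts, one quarter turn later.
[cite: DuminilCopinSmirnov2012Lattice, §8.3 (proof of Prop. 8.6)] -/
theorem rel_eq (hE : E.IsZdAdmissible) (hc₀ : E.IsStartCorner c₀) {N : ℕ}
    (hN : ¬ E.IsInnerFace (cFace (orb N))) (hlt : ∀ k < N, E.IsInnerFace (cFace (orb k)))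
    (hB : ∀ x ∈ cTgt p, x ∉ E.zdArcB) :
    (cTgt p ∉ β →
      dsum[β, c₀, N, p] - dsum[β, c₀, N, cornerPartner p] -
          I * (dsum[β, c₀, N, (p.1, p.2 + 1)] - dsum[β, c₀, N, ((cornerPartner p).1, (cornerPartner p).2 + 1)]) =
        (1 - I * 𝓊⁻¹) * (dsum[β, c₀, N, p] - dsum[β, c₀, N, cornerPartner p])) ∧
    (cTgt p ∈ β →
      dsum[β, c₀, N, p] - dsum[β, c₀, N, cornerPartner p] -
          I * (dsum[β, c₀, N, (p.1, p.2 + 1)] - dsum[β, c₀, N, ((cornerPartner p).1, (cornerPartner p).2 + 1)]) =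
        (1 + I * 𝓊) * (dsum[β, c₀, N, p] - dsum[β, c₀, N, cornerPartner p])) := by
  obtain ⟨h0, h0', hl, hl'⟩ := outDart_hypotheses hE hc₀ hN hlt hB
  have he2 : cTgt (cornerPartner p) = cTgt p := cTgt_partner p
  constructor
  · intro he
    have hp1 : prevCorner β (p.1, p.2 + 1) = p := by
      rw [← nextCorner_of_not_mem he, prevCorner_nextCorner]
    have hp2 : prevCorner β ((cornerPartner p).1, (cornerPartner p).2 + 1) = cornerPartner p := by
      rw [← nextCorner_of_not_mem (show cTgt (cornerPartner p) ∉ β by rwa [he2]), prevCorner_nextCorner]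
    rw [dsum_eq_dsum_prev h0 (by rwa [hp1]), dsum_eq_dsum_prev h0' (by rwa [hp2]), hp1, hp2,
      turnSign_of_not_mem he, turnSign_of_not_mem (show cTgt (cornerPartner p) ∉ β by rwa [he2]),
      zpow_neg_one]
    ring
  · intro he
    have hp1 : prevCorner β (p.1, p.2 + 1) = cornerPartner p := by
      rw [← nextCorner_partner_of_mem he, prevCorner_nextCorner]
    have hp2 : prevCorner β ((cornerPartner p).1, (cornerPartner p).2 + 1) = p := by
      have := @nextCorner_partner_of_mem (E.bcBondConfig ω) (cornerPartner p) (by rwa [he2])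
      rw [partner_partner] at this
      rw [← this, prevCorner_nextCorner]
    rw [dsum_eq_dsum_prev h0 (by rwa [hp1]), dsum_eq_dsum_prev h0' (by rwa [hp2]), hp1, hp2,
      turnSign_of_mem he, turnSign_of_mem (show cTgt (cornerPartner p) ∈ β by rwa [he2]),
      neg_neg, zpow_one]
    ring

/-! ### The in-dart differences of the pair (case 2: both darts of `e` on the path of `ω`) -/

/-- **The in-dart sums of the pair in case 2.** If the exploration of `ω` arrives at `e` through
`p` at time `i₁` and through its partner at time `i₂`, `i₁ < i₂ < N`, then (toggled exploration:
prefix kept, stretch `i₁+1 … i₂` excised, exit at `N - (i₂ - i₁)`): `dsum p = 𝓊^{-C}` in both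
configurations (`C` the common turn count at `i₁`), `dsum (partner p) = 0` in the toggled one and
`= 𝓊^{-C₂}` in the original one, with `C₂ - C = turnSign p + S`, `S` the turn-sign sum strictly
inside the excised stretch. [cite: DuminilCopinSmirnov2012Lattice, §8.3 (proof of Prop. 8.6)] -/
theorem dsum_case2 (hE : E.IsZdAdmissible) (hc₀ : E.IsStartCorner c₀)
    (hagree : ∀ e, e ≠ cTgt p → (e ∈ β' ↔ e ∈ β)) (hdiff : ¬ (cTgt p ∈ β' ↔ cTgt p ∈ β))
    {N i₁ i₂ : ℕ} (hlt : ∀ k < N, E.IsInnerFace (cFace (orb k))) (hi₁ : orb i₁ = p)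
    (hi₂ : orb i₂ = cornerPartner p) (h12 : i₁ < i₂) (hi₂N : i₂ < N) :
    dsum[β, c₀, N, p] = 𝓊 ^ (-turnCount β c₀ i₁) ∧
    dsum[β, c₀, N, cornerPartner p] =
      𝓊 ^ (-(turnCount β c₀ i₁ + turnSign β p +
        ∑ m ∈ Finset.range (i₂ - i₁ - 1), turnSign β (orb (i₁ + 1 + m)))) ∧
    dsum[β', c₀, N - (i₂ - i₁), p] = 𝓊 ^ (-turnCount β c₀ i₁) ∧
    dsum[β', c₀, N - (i₂ - i₁), cornerPartner p] = 0 ∧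
    (∑ m ∈ Finset.range (i₂ - i₁), turnSign β' (orb (i₁ + 1 + m)) =
      ∑ m ∈ Finset.range (i₂ - i₁ - 1), turnSign β (orb (i₁ + 1 + m)) + turnSign β' (cornerPartner p)) := by
  classical
  have hinj : ∀ a b, a < N → b < N → orb a = orb b → a = b := by
    intro a b ha hb h
    by_contra hne
    rcases Nat.lt_or_gt_of_ne hne with hab | hab
    · exact cornerOrbit_ne hE hc₀ hab (fun k hk => hlt k (by omega)) h
    · exact cornerOrbit_ne hE hc₀ hab (fun k hk => hlt k (by omega)) h.symm
  obtain ⟨hpre, htail⟩ := cornerOrbit_toggle_case2 hE hc₀ hagree hdiff hlt hi₁ hi₂ h12 hi₂N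
  have htgt : ∀ j < N, j ≠ i₁ → j ≠ i₂ → cTgt (orb j) ≠ cTgt p := by
    intro j hj h1 h2 h
    rcases cTgt_eq_cTgt_iff.1 h with h | h
    · exact h1 (hinj j i₁ hj (by omega) (h.trans hi₁.symm))
    · exact h2 (hinj j i₂ hj hi₂N (h.trans hi₂.symm))
  -- the filters
  have hf1 : (Finset.range N).filter (fun j => orb j = p) = {i₁} := by
    ext j
    simp only [Finset.mem_filter, Finset.mem_range, Finset.mem_singleton]
    exact ⟨fun ⟨hj, h⟩ => hinj j i₁ hj (by omega) (h.trans hi₁.symm), fun h => h ▸ ⟨by omega, hi₁⟩⟩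
  have hf2 : (Finset.range N).filter (fun j => orb j = cornerPartner p) = {i₂} := by
    ext j
    simp only [Finset.mem_filter, Finset.mem_range, Finset.mem_singleton]
    exact ⟨fun ⟨hj, h⟩ => hinj j i₂ hj hi₂N (h.trans hi₂.symm), fun h => h ▸ ⟨hi₂N, hi₂⟩⟩
  have horb' : ∀ j < N - (i₂ - i₁), (j ≤ i₁ ∧ orb' j = orb j) ∨ (i₁ < j ∧ orb' j = orb (j + (i₂ - i₁)) ∧ j + (i₂ - i₁) < N) := by
    intro j hj
    by_cases hji : j ≤ i₁
    · exact Or.inl ⟨hji, hpre j hji⟩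
    · right
      have ht := htail (j - i₁ - 1) (by omega)
      rw [show i₁ + 1 + (j - i₁ - 1) = j by omega, show i₂ + 1 + (j - i₁ - 1) = j + (i₂ - i₁) by omega] at ht
      exact ⟨not_le.1 hji, ht, by omega⟩
  have hf1' : (Finset.range (N - (i₂ - i₁))).filter (fun j => orb' j = p) = {i₁} := by
    ext j
    simp only [Finset.mem_filter, Finset.mem_range, Finset.mem_singleton]
    constructor
    · rintro ⟨hj, h⟩
      rcases horb' j hj with ⟨hji, he⟩ | ⟨hji, he, hlt'⟩
      · rw [he] at h; exact hinj j i₁ (by omega) (by omega) (h.trans hi₁.symm)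
      · rw [he] at h; have := hinj _ i₁ hlt' (by omega) (h.trans hi₁.symm); omega
    · rintro rfl
      exact ⟨by omega, by rw [hpre j le_rfl, hi₁]⟩
  have hf2' : (Finset.range (N - (i₂ - i₁))).filter (fun j => orb' j = cornerPartner p) = ∅ := by
    ext j
    simp only [Finset.mem_filter, Finset.mem_range, Finset.notMem_empty, iff_false, not_and]
    intro hj h
    rcases horb' j hj with ⟨hji, he⟩ | ⟨hji, he, hlt'⟩
    · rw [he] at h; have := hinj j i₂ (by omega) hi₂N (h.trans hi₂.symm); omega
    · rw [he] at h; have := hinj _ i₂ hlt' hi₂N (h.trans hi₂.symm); omega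
  -- turn counts
  have hC : turnCount β' c₀ i₁ = turnCount β c₀ i₁ :=
    turnCount_congr_prefix hpre fun j hj => hagree _ (htgt j (by omega) (by omega) (by omega))
  have hC₂ : turnCount β c₀ i₂ = turnCount β c₀ i₁ + turnSign β p +
      ∑ m ∈ Finset.range (i₂ - i₁ - 1), turnSign β (orb (i₁ + 1 + m)) := by
    have e : i₂ = i₁ + ((i₂ - i₁ - 1) + 1) := by omega
    conv_lhs => rw [e]
    rw [turnCount_add, Finset.sum_range_succ', add_zero, hi₁]
    have : ∀ m, i₁ + (m + 1) = i₁ + 1 + m := fun m => by omega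
    rw [Finset.sum_congr rfl (fun m _ => by rw [this m])]
    ring
  refine ⟨by rw [hf1, Finset.sum_singleton], by rw [hf2, Finset.sum_singleton, hC₂],
    by rw [hf1', Finset.sum_singleton, hC], by rw [hf2', Finset.sum_empty], ?_⟩
  have e : i₂ - i₁ = (i₂ - i₁ - 1) + 1 := by omega
  conv_lhs => rw [e]
  rw [Finset.sum_range_succ, show i₁ + 1 + (i₂ - i₁ - 1) = i₂ by omega, hi₂]
  congr 1
  refine Finset.sum_congr rfl fun m hm => ?_
  rw [Finset.mem_range] at hm
  exact turnSign_congr (hagree _ (htgt _ (by omega) (by omega) (by omega)))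

/-- The exit time of an orbit is unique. [cite: Smirnov2001, §2] -/
theorem exitIndex_unique :
    ∀ (E : DiscreteDobrushin) (b : BondConfig (Site 2)) (c : Site 2 × Fin 4) (M N : ℕ),
      ¬ E.IsInnerFace (cFace (cornerOrbit b c M)) → (∀ k < M, E.IsInnerFace (cFace (cornerOrbit b c k))) →
        ¬ E.IsInnerFace (cFace (cornerOrbit b c N)) → (∀ k < N, E.IsInnerFace (cFace (cornerOrbit b c k))) →
          M = N := by
  intro E βx c N₁ N₂ h1 h1' h2 h2'
  by_contra h
  rcases Nat.lt_or_gt_of_ne h with h | h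
  · exact h1 (h2' _ h)
  · exact h2 (h1' _ h)

end Pair

end Summit.CriticalPhenomena.CardyFormulaZ2.Cruxes.ParafermionPrecompact.KenyonStreamSecondRelation

end
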